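import Mathlib
import Summits.AtomisticToContinuum.Crystallization.Theses.GappedShellCensus
import Summits.AtomisticToContinuum.Crystallization.Theses.HullMinimality
import Summits.AtomisticToContinuum.Crystallization.Theorems.PhononSlackCertificatesPeriodicGivenLayered
import Summits.AtomisticToContinuum.Crystallization.Theorems.GappedShellCensusCleanLimitsHaveWindowsReduction
import Literature.MathematicalPhysics.StatisticalMechanics.BarlowStacking
import Literature.MathematicalPhysics.StatisticalMechanics.LocalMatchingCompactness
import Literature.Geometry.DiscreteGeometry.KissingPatterns

/-!
# `GappedShellCensus.CleanLimitsHaveWindows` (stmt-AtomisticToContinuum-15932): the LAMINAR GLUE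

`cleanLimitsHaveWindows_of_laminar : LaminarHull → LaminarPinning → CleanLimitsHaveWindows` — the route-level split of the
crux prepared by the crux strategist (`Cruxes/CleanLimitsHaveWindows/STRATEGY-CENSUS.md`, line `laminar-chain`), landed by the
lead of line `Sketch` so that a planner can run `route edit --split CleanLimitsHaveWindows … --glue-by` this theorem.
The two hypotheses are spelled out inline (no auxiliary predicates; the two-way ball matching of the recurrence clause is
written out so that both binder types elaborate in the route file's import closure):

* `LaminarHull` (the kernel, XL): a rooted, everywhere-clean, rooted-uniformly recurrent hull element `Z` of a Lennard-Jones
  ground-state sequence (scale `a ∈ [47/50, 1]`) is LAMINAR — `Z = v₀ + A{ i u + j v + w m + (z m) e₃ }` with horizontal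
  generators `u, v` in the bond band, horizontal per-layer offsets `w m` and strictly increasing heights `z m`;
* `LaminarPinning` (finite-fibre chain, L): such a laminar hull element is EXACTLY LAYERED (equilateral metric, hollow-site
  registry along a Hägg word) — verbatim the input format of the landed `CleanHull.boxPinning`.

Proof of the glue: soft half (`CleanHull.cleanHullRecurrent`, landed) ⇒ `LaminarHull` ⇒ `LaminarPinning` ⇒ box pinning
(`CleanHull.boxPinning`, landed) ⇒ the PROVED `LayeredHull.PeriodicGivenLayered_proof` (stmt-11779). [folklore]
-/

noncomputable section

namespace Summit.AtomisticToContinuum.Crystallization.Theorems.CleanHull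

open scoped BigOperators
open Filter Metric
open Literature.MathematicalPhysics.StatisticalMechanics
open Literature.Geometry.DiscreteGeometry

/-- **The laminar glue.** `GappedShellCensus.CleanLimitsHaveWindows` (stmt-AtomisticToContinuum-15932) follows from the two
laminar children: `LaminarHull` (rooted clean recurrent hull elements of LJ ground-state sequences are laminar) and
`LaminarPinning` (laminar such hull elements are exactly layered). Both hypotheses are stated inline, with the recurrence clause's
two-way ball matching written out. [folklore] -/
theorem cleanLimitsHaveWindows_of_laminar
    (hHull : ∀ x : (N : ℕ) → (Fin N → EuclideanSpace ℝ (Fin 3)),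
      (∀ N, IsGroundState lennardJones (x N)) →
      ∀ (Z : Set (EuclideanSpace ℝ (Fin 3))) (a : ℝ), 47 / 50 ≤ a → a ≤ 1 → (0 : EuclideanSpace ℝ (Fin 3)) ∈ Z →
      (∀ R ε : ℝ, 0 < ε → ∃ᶠ N in Filter.atTop, ∃ t : EuclideanSpace ℝ (Fin 3), (∀ p ∈ Z, ‖p‖ ≤ R →
          ∃ i : Fin N, dist (x N i + t) p ≤ ε) ∧ (∀ i : Fin N, ‖x N i + t‖ ≤ R → ∃ p ∈ Z, dist (x N i + t) p ≤ ε)) →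
      (∀ y ∈ Z, ({w ∈ Z | w ≠ y ∧ dist y w ≤ a * (1 + 1 / 50)}.ncard = 12 ∧ ∀ w ∈ Z, w ≠ y →
          a * (1 - 1 / 50) ≤ dist y w ∧ (dist y w ≤ a * (1 + 1 / 50) ∨ a * (63 / 50) ≤ dist y w)) ∧
          (∃ T : Finset (EuclideanSpace ℝ (Fin 3)),
          (↑T : Set (EuclideanSpace ℝ (Fin 3))) = (fun w => a⁻¹ • (w - y)) ''
              {w ∈ Z | w ≠ y ∧ dist y w ≤ a * (1 + 1 / 50)} ∧
              (ShellCloseTo (1 / 5) T fccKissingPattern ∨ ShellCloseTo (1 / 5) T hcpKissingPattern))) →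
      (∀ R ε : ℝ, 0 < ε → ∃ G : ℝ, ∀ w ∈ Z, ∃ g ∈ Z, dist g w ≤ G ∧
          ((∀ s ∈ Z, dist s (0 : EuclideanSpace ℝ (Fin 3)) ≤ R → ∃ q ∈ (fun p => p - g) '' Z, dist q s ≤ ε) ∧
           (∀ q ∈ (fun p => p - g) '' Z, dist q (0 : EuclideanSpace ℝ (Fin 3)) ≤ R → ∃ s ∈ Z, dist q s ≤ ε))) →
      ∃ (A : EuclideanSpace ℝ (Fin 3) →ₗᵢ[ℝ] EuclideanSpace ℝ (Fin 3)) (u v : EuclideanSpace ℝ (Fin 3))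
        (w : ℤ → EuclideanSpace ℝ (Fin 3)) (z : ℤ → ℝ) (v₀ : EuclideanSpace ℝ (Fin 3)),
        u 2 = 0 ∧ v 2 = 0 ∧ (∀ m : ℤ, w m 2 = 0) ∧
        (a * (1 - 1 / 50) ≤ ‖u‖ ∧ ‖u‖ ≤ a * (1 + 1 / 50)) ∧ (a * (1 - 1 / 50) ≤ ‖v‖ ∧ ‖v‖ ≤ a * (1 + 1 / 50)) ∧
        (a * (1 - 1 / 50) ≤ ‖u - v‖ ∧ ‖u - v‖ ≤ a * (1 + 1 / 50)) ∧ (∀ m : ℤ, z m < z (m + 1)) ∧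
        Z = (fun p => p + v₀) '' {p : EuclideanSpace ℝ (Fin 3) | ∃ m i j : ℤ,
          p = A (((i : ℝ) • u) + ((j : ℝ) • v) + w m + (z m • layerNormal 1))})
    (hPin : ∀ x : (N : ℕ) → (Fin N → EuclideanSpace ℝ (Fin 3)),
      (∀ N, IsGroundState lennardJones (x N)) →
      ∀ (Z : Set (EuclideanSpace ℝ (Fin 3))) (a : ℝ), 47 / 50 ≤ a → a ≤ 1 → (0 : EuclideanSpace ℝ (Fin 3)) ∈ Z →
      (∀ R ε : ℝ, 0 < ε → ∃ᶠ N in Filter.atTop, ∃ t : EuclideanSpace ℝ (Fin 3), (∀ p ∈ Z, ‖p‖ ≤ R →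
          ∃ i : Fin N, dist (x N i + t) p ≤ ε) ∧ (∀ i : Fin N, ‖x N i + t‖ ≤ R → ∃ p ∈ Z, dist (x N i + t) p ≤ ε)) →
      (∀ y ∈ Z, ({w ∈ Z | w ≠ y ∧ dist y w ≤ a * (1 + 1 / 50)}.ncard = 12 ∧ ∀ w ∈ Z, w ≠ y →
          a * (1 - 1 / 50) ≤ dist y w ∧ (dist y w ≤ a * (1 + 1 / 50) ∨ a * (63 / 50) ≤ dist y w)) ∧
          (∃ T : Finset (EuclideanSpace ℝ (Fin 3)),
          (↑T : Set (EuclideanSpace ℝ (Fin 3))) = (fun w => a⁻¹ • (w - y)) ''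
              {w ∈ Z | w ≠ y ∧ dist y w ≤ a * (1 + 1 / 50)} ∧
              (ShellCloseTo (1 / 5) T fccKissingPattern ∨ ShellCloseTo (1 / 5) T hcpKissingPattern))) →
      (∀ R ε : ℝ, 0 < ε → ∃ G : ℝ, ∀ w ∈ Z, ∃ g ∈ Z, dist g w ≤ G ∧
          ((∀ s ∈ Z, dist s (0 : EuclideanSpace ℝ (Fin 3)) ≤ R → ∃ q ∈ (fun p => p - g) '' Z, dist q s ≤ ε) ∧
           (∀ q ∈ (fun p => p - g) '' Z, dist q (0 : EuclideanSpace ℝ (Fin 3)) ≤ R → ∃ s ∈ Z, dist q s ≤ ε))) →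
      (∃ (A : EuclideanSpace ℝ (Fin 3) →ₗᵢ[ℝ] EuclideanSpace ℝ (Fin 3)) (u v : EuclideanSpace ℝ (Fin 3))
        (w : ℤ → EuclideanSpace ℝ (Fin 3)) (z : ℤ → ℝ) (v₀ : EuclideanSpace ℝ (Fin 3)),
        u 2 = 0 ∧ v 2 = 0 ∧ (∀ m : ℤ, w m 2 = 0) ∧
        (a * (1 - 1 / 50) ≤ ‖u‖ ∧ ‖u‖ ≤ a * (1 + 1 / 50)) ∧ (a * (1 - 1 / 50) ≤ ‖v‖ ∧ ‖v‖ ≤ a * (1 + 1 / 50)) ∧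
        (a * (1 - 1 / 50) ≤ ‖u - v‖ ∧ ‖u - v‖ ≤ a * (1 + 1 / 50)) ∧ (∀ m : ℤ, z m < z (m + 1)) ∧
        Z = (fun p => p + v₀) '' {p : EuclideanSpace ℝ (Fin 3) | ∃ m i j : ℤ,
          p = A (((i : ℝ) • u) + ((j : ℝ) • v) + w m + (z m • layerNormal 1))}) →
      ∃ (a' : ℝ) (A : EuclideanSpace ℝ (Fin 3) →ₗᵢ[ℝ] EuclideanSpace ℝ (Fin 3)) (s : ℤ → ℤ) (z : ℤ → ℝ)
        (v : EuclideanSpace ℝ (Fin 3)), 0 < a' ∧ IsHaggSeq s ∧ (∀ m : ℤ, 0 < z (m + 1) - z m) ∧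
        Z = (fun p => p + v) '' {p | ∃ m i j : ℤ, p = A (((i : ℝ) • triangularVec₁ a') +
          ((j : ℝ) • triangularVec₂ a') + ((haggLabel s m : ℝ) • barlowOffset a') + (z m • layerNormal 1))}) :
    Summit.AtomisticToContinuum.Crystallization.Theses.GappedShellCensus.CleanLimitsHaveWindows := by
  intro x hx Y a ha ha1 h0 hlim hclean
  have ha0 : 0 < a := by linarith
  -- soft half: a rooted, uniformly recurrent, clean hull element (landed)
  obtain ⟨Z, hZ0, hZH, hZc, hZr⟩ := cleanHullRecurrent x ha0 h0 (inHull_of_isSubseqLimit hlim) hclean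
  -- the recurrence clause with the two-way ball matching written out (definitional)
  have hZr' : ∀ R ε : ℝ, 0 < ε → ∃ G : ℝ, ∀ w ∈ Z, ∃ g ∈ Z, dist g w ≤ G ∧
      ((∀ s ∈ Z, dist s (0 : EuclideanSpace ℝ (Fin 3)) ≤ R → ∃ q ∈ (fun p => p - g) '' Z, dist q s ≤ ε) ∧
       (∀ q ∈ (fun p => p - g) '' Z, dist q (0 : EuclideanSpace ℝ (Fin 3)) ≤ R → ∃ s ∈ Z, dist q s ≤ ε)) :=
    hZr
  -- laminar hull (child 1) and laminar pinning (child 2): an exactly layered hull element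
  obtain ⟨a', A, s, z, v, ha', hs, hz, hZeq⟩ :=
    hPin x hx Z a ha ha1 hZ0 hZH hZc hZr' (hHull x hx Z a ha ha1 hZ0 hZH hZc hZr')
  -- box pinning (landed): a layered hull element with parameters in the box of stmt-11779
  obtain ⟨a'', A', s', z', h1, h2, hs', hz', hH'⟩ :=
    boxPinning x hx a a' ha ha1 ha' A s z v hs hz Z hZeq hZc hZH (hZeq ▸ hZr)
  -- exit through the proved crux `PeriodicGivenLayered`
  exact LayeredHull.PeriodicGivenLayered_proof x hx ⟨a'', h1, h2, fun R ε hε =>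
    (hH' R ε hε).mono fun N hN => by
      obtain ⟨t, ht⟩ := hN
      exact ⟨A', t, s', z', hs', hz', ht⟩⟩

end Summit.AtomisticToContinuum.Crystallization.Theorems.CleanHull

end
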